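/-
Origin: expansion seat `planner-pub-hodgecm-pv03-0`, handover v7.3 2026-08-18 (`HOME/pub-hodgecm-pv03/lean/Pv03/PerL34/BallFrame.lean`, md5 19a49ace, 309 lines);
landed by the gen-6 packager in gate run 22 as `HodgeCM/PerL34/BallFrame.lean` (verbatim).
-/
/-
pub-hodgecm cell pv03 (session planner-pub-hodgecm-pv03-0, unit pub-hodgecm-pv03), node N33 (PerL v5 Prop 4.3).
`BallFrame`: the frame bundle of `𝔹² = U(2,1)/K` is TRIVIALISED by an explicit global section, and the dictionary
sentence `LineSpans.HolFromBall` of `BallSpans` (D2/D6) is thereby reduced to an INTRINSIC condition on pv02's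
group-level functions.  Proposed place: `HodgeCM/PerL34/BallFrame.lean` (after `BallSpans`).
-/
import Summits.HodgeConjecture.HodgeCM.PerL34.BallSpans

/-!
# A global section of `U(2,1) → 𝔹²` and the frame dictionary as a bijection

For the canonical ball model (`BallModel`: `U21 = U(2,1)`, `Ball = 𝔹²`, `x₀ = 0`, cotangent cocycle `A`) and pv14's
frame reading `R u g = A g⁻¹ (g·x₀) (u (g·x₀))` (`BallSpans.R`):

* `secMat z` — the Hermitian boost `g_z = ((1 + a z z*, c z), (c z*, c))`, `c = (1-|z|²)^{-1/2}`, `a = c²/(1+c)`,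
  written without singularity as `a = 1/(t(1+t))`, `c = 1/t`, `t = (1-|z|²)^{1/2}`; `secMat_mem : g_zᴴ J g_z = J`,
  `sec z ∈ U(2,1)`, `sec_smul_x₀ : sec z · x₀ = z`, `continuous_sec` (a continuous global section of the orbit map;
  in particular a second, case-free proof of `Print_transitive`);
* `IsFrameFn φ` — right `K`-equivariance of `φ : U(2,1) → ℂ²` through the isotropy cocycle,
  `φ (g k) = A k⁻¹ x₀ (φ g)` for `k·x₀ = x₀`; every frame reading `R u` is one (`isFrameFn_R`);
* `liftForm φ x = A (sec x) x₀ (φ (sec x))`; `R (liftForm φ) = φ` for frame functions (`R_liftForm`) and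
  `liftForm φ` is continuous when `φ` is (`continuous_liftForm`);
* hence `holFromBall_of_frame`: the D2/D6 sentence `HolFromBall` ("every `φ ∈ Hol` is the frame reading of a
  continuous one-form on the ball") FOLLOWS from the intrinsic description "`Hol` consists of continuous, right
  `K`-equivariant `ℂ²`-valued functions on `U(2,1)`" (`HolFrame`), which is how the producers' shells (pv02
  `P43_lineSpan`, pv14 `P43_thetaKernel`) describe holomorphic one-forms in the first place; and conversely
  (`continuous_R`, joint continuity `continuous_coT₂`), so that `holFrame_iff : HolFrame S ↔ S.HolFromBall`.

Nothing is posited and nothing is cited: plain matrix algebra over `Mathlib`.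
-/

set_option autoImplicit false

noncomputable section

open Complex ComplexConjugate
open scoped Matrix

namespace HodgeCM
namespace PerL34
namespace BallFrame

open HodgeCM.PerL34.BallModel HodgeCM.PerL34.BallSpans HodgeCM.PerL34.WedgeNonvanishing

/-! ## The inverse in `U(2,1)` -/

/-- (Ported verbatim from the HodgeCMPerL package; no docstring in the source.) -/
theorem J_mul_J : J * J = 1 := by
  ext i j
  fin_cases i <;> fin_cases j <;> simp [J, Matrix.mul_apply, Matrix.diagonal_apply]

/-- `g⁻¹ = J gᴴ J` for `g ∈ U(2,1)`. -/
theorem mat_inv (g : U21) : mat g⁻¹ = J * (mat g)ᴴ * J := by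
  have h1 : J * (mat g)ᴴ * J * mat g = 1 := by
    calc J * (mat g)ᴴ * J * mat g = J * ((mat g)ᴴ * J * mat g) := by simp only [Matrix.mul_assoc]
      _ = 1 := by rw [mat_mem, J_mul_J]
  have h2 : mat g⁻¹ * mat g = 1 := by rw [← mat_mul, inv_mul_cancel, mat_one]
  exact (Matrix.inv_eq_left_inv h2).symm.trans (Matrix.inv_eq_left_inv h1)

/-! ## The global section `z ↦ g_z` -/

/-- `t(z) = (1 - |z|²)^{1/2} > 0`. -/
def tOf (z : Ball) : ℝ := Real.sqrt (1 - nsq z.1)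

/-- (Ported verbatim from the HodgeCMPerL package; no docstring in the source.) -/
theorem tOf_pos (z : Ball) : 0 < tOf z := Real.sqrt_pos.2 (by have := z.2; linarith)

/-- (Ported verbatim from the HodgeCMPerL package; no docstring in the source.) -/
theorem tOf_sq (z : Ball) : tOf z ^ 2 = 1 - nsq z.1 := Real.sq_sqrt (by have := z.2; linarith)

/-- `c(z) = (1 - |z|²)^{-1/2}`. -/
def cOf (z : Ball) : ℝ := 1 / tOf z

/-- `a(z) = c²/(1+c) = 1/(t(1+t))`. -/
def aOf (z : Ball) : ℝ := 1 / (tOf z * (1 + tOf z))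

/-- (Ported verbatim from the HodgeCMPerL package; no docstring in the source.) -/
theorem cOf_pos (z : Ball) : 0 < cOf z := by unfold cOf; exact div_pos one_pos (tOf_pos z)

/-- The Hermitian boost `g_z = ((1 + a z z*, c z), (c z*, c))`. -/
def secMat (z : Ball) : Matrix (Fin 3) (Fin 3) ℂ :=
  !![1 + (aOf z : ℂ) * z.1 0 * conj (z.1 0), (aOf z : ℂ) * z.1 0 * conj (z.1 1), (cOf z : ℂ) * z.1 0;
     (aOf z : ℂ) * z.1 1 * conj (z.1 0), 1 + (aOf z : ℂ) * z.1 1 * conj (z.1 1), (cOf z : ℂ) * z.1 1;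
     (cOf z : ℂ) * conj (z.1 0), (cOf z : ℂ) * conj (z.1 1), (cOf z : ℂ)]

/-- The three scalar identities behind `g_zᴴ J g_z = J`: `2a + a²|z|² = c²`, `1 + a|z|² = c`, `c²(1-|z|²) = 1`. -/
theorem sec_identities (z : Ball) :
    (2 * (aOf z : ℂ) + (aOf z : ℂ) ^ 2 * (conj (z.1 0) * z.1 0 + conj (z.1 1) * z.1 1) = (cOf z : ℂ) ^ 2) ∧
    (1 + (aOf z : ℂ) * (conj (z.1 0) * z.1 0 + conj (z.1 1) * z.1 1) = (cOf z : ℂ)) ∧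
    ((cOf z : ℂ) ^ 2 * (1 - (conj (z.1 0) * z.1 0 + conj (z.1 1) * z.1 1)) = 1) := by
  have ht := tOf_pos z
  have ht0 : tOf z ≠ 0 := ht.ne'
  have ht1 : 1 + tOf z ≠ 0 := by have : (0 : ℝ) < 1 + tOf z := by linarith
                                 exact this.ne'
  have hs : nsq z.1 = 1 - tOf z ^ 2 := by rw [tOf_sq]; ring
  have hS : conj (z.1 0) * z.1 0 + conj (z.1 1) * z.1 1 = ((nsq z.1 : ℝ) : ℂ) := by
    rw [conj_mul', conj_mul']
    push_cast [nsq]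
    ring
  have h1 : 2 * aOf z + aOf z ^ 2 * nsq z.1 = cOf z ^ 2 := by
    simp only [aOf, cOf]; rw [hs]; field_simp; ring
  have h2 : 1 + aOf z * nsq z.1 = cOf z := by
    simp only [aOf, cOf]; rw [hs]; field_simp; ring
  have h3 : cOf z ^ 2 * (1 - nsq z.1) = 1 := by
    simp only [cOf]; rw [hs]; field_simp; ring
  refine ⟨?_, ?_, ?_⟩
  · rw [hS]; exact_mod_cast h1
  · rw [hS]; exact_mod_cast h2
  · rw [hS]; exact_mod_cast h3

/-- (Ported verbatim from the HodgeCMPerL package; no docstring in the source.) -/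
theorem secMat_mem (z : Ball) : (secMat z)ᴴ * J * secMat z = J := by
  obtain ⟨h1, h2, h3⟩ := sec_identities z
  ext i j
  fin_cases i <;> fin_cases j <;>
    simp [secMat, J, Matrix.mul_apply, Fin.sum_univ_three, Matrix.conjTranspose_apply, Matrix.diagonal_apply] <;>
    first
    | linear_combination (z.1 0 * conj (z.1 0)) * h1
    | linear_combination (z.1 0 * conj (z.1 1)) * h1
    | linear_combination (z.1 1 * conj (z.1 0)) * h1
    | linear_combination (z.1 1 * conj (z.1 1)) * h1
    | linear_combination ((cOf z : ℂ) * z.1 0) * h2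
    | linear_combination ((cOf z : ℂ) * z.1 1) * h2
    | linear_combination ((cOf z : ℂ) * conj (z.1 0)) * h2
    | linear_combination ((cOf z : ℂ) * conj (z.1 1)) * h2
    | linear_combination (-1 : ℂ) * h3

/-- The global section `sec : 𝔹² → U(2,1)`. -/
def sec (z : Ball) : U21 := mkU21 (secMat z) (secMat_mem z)

/-- (Ported verbatim from the HodgeCMPerL package; no docstring in the source.) -/
@[simp] theorem mat_sec (z : Ball) : mat (sec z) = secMat z := rfl

/-- `g_z · x₀ = z`. -/
theorem sec_smul_x₀ (z : Ball) : sec z • x₀ = z := by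
  have hc : (cOf z : ℂ) ≠ 0 := by exact_mod_cast (cOf_pos z).ne'
  apply Ball.ext
  intro i
  rw [smul_val, W3_apply, W3_apply]
  fin_cases i
  · simp [secMat]; field_simp
  · simp [secMat]; field_simp

/-- (Ported verbatim from the HodgeCMPerL package; no docstring in the source.) -/
theorem continuous_nsq : Continuous nsq := by
  unfold nsq
  exact ((continuous_norm.comp (continuous_apply 0)).pow 2).add ((continuous_norm.comp (continuous_apply 1)).pow 2)

/-- (Ported verbatim from the HodgeCMPerL package; no docstring in the source.) -/
theorem continuous_tOf : Continuous tOf :=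
  Real.continuous_sqrt.comp (continuous_const.sub (continuous_nsq.comp continuous_subtype_val))

/-- (Ported verbatim from the HodgeCMPerL package; no docstring in the source.) -/
theorem continuous_cOf : Continuous cOf := by
  unfold cOf
  exact continuous_const.div continuous_tOf fun z => (tOf_pos z).ne'

/-- (Ported verbatim from the HodgeCMPerL package; no docstring in the source.) -/
theorem continuous_aOf : Continuous aOf := by
  unfold aOf
  refine continuous_const.div (continuous_tOf.mul (continuous_const.add continuous_tOf)) fun z => ?_
  have h1 := tOf_pos z
  exact mul_ne_zero h1.ne' (by linarith : (0 : ℝ) < 1 + tOf z).ne'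

/-- (Ported verbatim from the HodgeCMPerL package; no docstring in the source.) -/
theorem continuous_secMat : Continuous secMat := by
  have hu : Continuous fun z : Ball => z.1 0 := (continuous_apply 0).comp continuous_subtype_val
  have hv : Continuous fun z : Ball => z.1 1 := (continuous_apply 1).comp continuous_subtype_val
  have hcu : Continuous fun z : Ball => conj (z.1 0) := continuous_conj.comp hu
  have hcv : Continuous fun z : Ball => conj (z.1 1) := continuous_conj.comp hv
  have ha : Continuous fun z : Ball => (aOf z : ℂ) := continuous_ofReal.comp continuous_aOf
  have hc : Continuous fun z : Ball => (cOf z : ℂ) := continuous_ofReal.comp continuous_cOf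
  refine continuous_matrix fun i j => ?_
  fin_cases i <;> fin_cases j <;>
    simp only [secMat, Matrix.of_apply, Matrix.cons_val', Matrix.cons_val_zero, Matrix.cons_val_one,
      Matrix.empty_val', Matrix.cons_val_fin_one, Matrix.cons_val_two, Matrix.tail_cons, Matrix.head_cons,
      Fin.isValue, Fin.mk_one, Fin.reduceFinMk] <;>
    first
    | exact continuous_const.add ((ha.mul hu).mul hcu)
    | exact (ha.mul hu).mul hcv
    | exact hc.mul hu
    | exact (ha.mul hv).mul hcu
    | exact continuous_const.add ((ha.mul hv).mul hcv)
    | exact hc.mul hv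
    | exact hc.mul hcu
    | exact hc.mul hcv
    | exact hc

/-- The section is continuous (into `U(2,1) ≤ GL₃(ℂ)` with its group topology). -/
theorem continuous_sec : Continuous sec := by
  have hval : Continuous fun z : Ball => ((sec z : GL3) : Matrix (Fin 3) (Fin 3) ℂ) := continuous_secMat
  have hinv : Continuous fun z : Ball => (((sec z : GL3)⁻¹ : GL3) : Matrix (Fin 3) (Fin 3) ℂ) := by
    have : ∀ z : Ball, (((sec z : GL3)⁻¹ : GL3) : Matrix (Fin 3) (Fin 3) ℂ) = J * (secMat z)ᴴ * J := fun z => by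
      have h1 : J * (secMat z)ᴴ * J * secMat z = 1 := by
        calc J * (secMat z)ᴴ * J * secMat z = J * ((secMat z)ᴴ * J * secMat z) := by simp only [Matrix.mul_assoc]
          _ = 1 := by rw [secMat_mem, J_mul_J]
      rw [Matrix.coe_units_inv]
      exact Matrix.inv_eq_left_inv h1
    simp_rw [this]
    exact (continuous_const.mul continuous_secMat.matrix_conjTranspose).mul continuous_const
  have hGL : Continuous fun z : Ball => (sec z : GL3) := Units.continuous_iff.2 ⟨hval, hinv⟩
  exact hGL.subtype_mk _

/-! ## Frame functions and the lift -/

/-- Right `K`-equivariance of `φ : U(2,1) → ℂ²` through the isotropy cocycle at `x₀`. -/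
def IsFrameFn (φ : U21 → (Fin 2 → ℂ)) : Prop :=
  ∀ g k : U21, k • x₀ = x₀ → φ (g * k) = A k⁻¹ x₀ (φ g)

/-- (Ported verbatim from the HodgeCMPerL package; no docstring in the source.) -/
theorem A_one (z : Ball) (w : Fin 2 → ℂ) : A 1 z w = w := by
  have h := cocycle 1 1 z w
  rw [mul_one, one_smul] at h
  exact (A_injective 1 z h).symm

/-- Every frame reading is a frame function. -/
theorem isFrameFn_R (u : Ball → (Fin 2 → ℂ)) : IsFrameFn (R u) := by
  intro g k hk
  rw [R_apply, R_apply, mul_smul, hk, mul_inv_rev, cocycle, inv_smul_smul]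

/-- The lift of a function on the group to the ball along the section. -/
def liftForm (φ : U21 → (Fin 2 → ℂ)) : Ball → (Fin 2 → ℂ) := fun x => A (sec x) x₀ (φ (sec x))

/-- (Ported verbatim from the HodgeCMPerL package; no docstring in the source.) -/
theorem continuous_liftForm {φ : U21 → (Fin 2 → ℂ)} (hφ : Continuous φ) : Continuous (liftForm φ) := by
  show Continuous fun x => A (sec x) x₀ (φ (sec x))
  simp only [A_apply]
  exact ((continuous_coT x₀).comp continuous_sec).matrix_mulVec (hφ.comp continuous_sec)

/-- The frame reading of the lift of a frame function is the function. -/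
theorem R_liftForm {φ : U21 → (Fin 2 → ℂ)} (hφ : IsFrameFn φ) : R (liftForm φ) = φ := by
  funext g
  rw [R_apply]
  show A g⁻¹ (g • x₀) (A (sec (g • x₀)) x₀ (φ (sec (g • x₀)))) = φ g
  set s : U21 := sec (g • x₀) with hs_def
  have hs : s • x₀ = g • x₀ := sec_smul_x₀ _
  have hk : (g⁻¹ * s) • x₀ = x₀ := by rw [mul_smul, hs, inv_smul_smul]
  have hφs : φ s = A (g⁻¹ * s)⁻¹ x₀ (φ g) := by
    have := hφ g (g⁻¹ * s) hk
    rwa [mul_inv_cancel_left] at this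
  have hm : (g⁻¹ * s)⁻¹ • x₀ = x₀ := by
    rw [mul_inv_rev, inv_inv, mul_smul, ← hs, inv_smul_smul]
  have hg : s * (g⁻¹ * s)⁻¹ = g := by
    rw [mul_inv_rev, inv_inv, ← mul_assoc, mul_inv_cancel, one_mul]
  have step1 : A s x₀ (A (g⁻¹ * s)⁻¹ x₀ (φ g)) = A g x₀ (φ g) := by
    have hc := cocycle s (g⁻¹ * s)⁻¹ x₀ (φ g)
    rw [hm, hg] at hc
    exact hc.symm
  have step2 : A g⁻¹ (g • x₀) (A g x₀ (φ g)) = φ g := by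
    have hc := cocycle g⁻¹ g x₀ (φ g)
    rw [inv_mul_cancel, A_one] at hc
    exact hc.symm
  rw [hφs, step1, step2]

/-- Conversely, lifting the frame reading of ANY `u : 𝔹² → ℂ²` returns `u`: `liftForm` and `R` are mutually
inverse between functions on the ball and frame functions on the group. -/
theorem liftForm_R (u : Ball → (Fin 2 → ℂ)) : liftForm (R u) = u := by
  funext x
  show A (sec x) x₀ (A (sec x)⁻¹ (sec x • x₀) (u (sec x • x₀))) = u x
  rw [sec_smul_x₀]
  have hm : (sec x)⁻¹ • x = x₀ := by rw [inv_smul_eq_iff, sec_smul_x₀]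
  have hc := cocycle (sec x) (sec x)⁻¹ x (u x)
  rw [mul_inv_cancel, A_one, hm] at hc
  exact hc.symm

/-- `R` maps the functions on the ball ONTO the frame functions (injectivity is `BallSpans.R_injective`). -/
theorem exists_eq_R_of_isFrameFn {φ : U21 → (Fin 2 → ℂ)} (hφ : IsFrameFn φ) : ∃ u : Ball → (Fin 2 → ℂ), R u = φ :=
  ⟨liftForm φ, R_liftForm hφ⟩

/-! ## The dictionary sentence in group language -/

/-- **D2/D6 in the producers' language (DEFINITIONAL):** `Hol` consists of continuous `ℂ²`-valued functions on
`U(2,1)` that are right `K`-equivariant through the isotropy (cotangent) representation — the standard description of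
continuous one-forms on `𝔹² = U(2,1)/K` as functions on the group. -/
def HolFrame (S : LineSpans) : Prop := ∀ φ ∈ S.Hol, Continuous φ ∧ IsFrameFn φ

/-- `HolFrame ⇒ HolFromBall`: every continuous frame function is the frame reading of a continuous one-form on the
ball (its lift along the global section). -/
theorem holFromBall_of_frame (S : LineSpans) (h : HolFrame S) : S.HolFromBall := fun φ hφ =>
  ⟨liftForm φ, continuous_liftForm (h φ hφ).1, R_liftForm (h φ hφ).2⟩

/-! ## The converse: frame readings of continuous one-forms are continuous frame functions -/

/-- (Ported verbatim from the HodgeCMPerL package; no docstring in the source.) -/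
theorem continuous_Jac₂ : Continuous fun p : U21 × Ball => Jac p.1 p.2 := by
  have hm : Continuous fun p : U21 × Ball => mat p.1 := continuous_mat.comp continuous_fst
  refine continuous_matrix fun i j => ?_
  simp only [Jac, Matrix.of_apply]
  exact (((hm.matrix_elem _ _).mul (continuous_W3 2)).sub ((continuous_W3 _).mul (hm.matrix_elem _ _))).div
    ((continuous_W3 2).pow 2) fun p => pow_ne_zero _ (W3_2_ne_zero p.1 p.2)

/-- Joint continuity of the cotangent cocycle in `(g, z)`. -/
theorem continuous_coT₂ : Continuous fun p : U21 × Ball => coT p.1 p.2 := by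
  have hJ := continuous_Jac₂
  have hd : Continuous fun p : U21 × Ball => ((Jac p.1 p.2).det)⁻¹ :=
    (hJ.matrix_det).inv₀ fun p => det_Jac_ne_zero p.1 p.2
  refine hd.smul (continuous_matrix fun i j => ?_)
  fin_cases i <;> fin_cases j <;>
    simp only [Matrix.of_apply, Matrix.cons_val', Matrix.empty_val', Matrix.cons_val_fin_one]
  · exact hJ.matrix_elem 1 1
  · exact (hJ.matrix_elem 1 0).neg
  · exact (hJ.matrix_elem 0 1).neg
  · exact hJ.matrix_elem 0 0

/-- The frame reading of a continuous one-form is continuous on `U(2,1)`. -/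
theorem continuous_R {u : Ball → (Fin 2 → ℂ)} (hu : Continuous u) : Continuous (R u) := by
  show Continuous fun g : U21 => A g⁻¹ (g • x₀) (u (g • x₀))
  simp only [A_apply]
  have h0 : Continuous fun g : U21 => g • x₀ := continuous_id.smul continuous_const
  have h1 : Continuous fun g : U21 => (g⁻¹, g • x₀) := continuous_inv.prodMk h0
  exact (continuous_coT₂.comp h1).matrix_mulVec (hu.comp h0)

/-- (Ported verbatim from the HodgeCMPerL package; no docstring in the source.) -/
theorem holFrame_of_holFromBall (S : LineSpans) (h : S.HolFromBall) : HolFrame S := fun φ hφ => by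
  obtain ⟨u, hu, rfl⟩ := h φ hφ
  exact ⟨continuous_R hu, isFrameFn_R u⟩

/-- **The D2/D6 dictionary is exact:** `HolFrame S ↔ S.HolFromBall`. -/
theorem holFrame_iff (S : LineSpans) : HolFrame S ↔ S.HolFromBall :=
  ⟨holFromBall_of_frame S, holFrame_of_holFromBall S⟩

end BallFrame
end PerL34
end HodgeCM
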